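import Literature.Analysis.ValidatedNumerics.RBoxInfeasibility
import Mathlib.Tactic.IntervalCases
import HarnessLib

/-!
# `RobustTangencyBound` — the kernel certificates of the isolated-soft-rhombus lemma (step (III),
# robust Bezdek–Reid Lemma 4, "diagonal form")

Route `TwoCentreKissingKernel`, item `stmt-AtomisticToContinuum-12082`, blueprint (III) §5–6.  An isolated soft
rhombus `v a w c` of the hull of a soft twelve-point shell (long hull edge `{v, w}`, triangular facets
`{v,w,a}`, `{v,w,c}` with soft sides, every other facet through `v` and through `a` a soft triangle)
gives, with `x = ⟪v,w⟫`, the soft sides `s₁ = ⟪v,a⟫, s₂ = ⟪a,w⟫, s₃ = ⟪w,c⟫, s₄ = ⟪c,v⟫` and the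
cosines/sines `(C_j, S_j)` of the `m_v` resp. `m_a` regular corners at `v` resp. `a`, a real solution
of the system `rhombusSys m_v m_a` in the box `rhombusBox m_v m_a`:

* corner cosines in forward form `cornerR N D² = (N/√D², √(1 − (N/√D²)²))` for the two half-rhombus
  corners at `v` (`N = s₂ − s₁x`, `D² = (1 − s₁²)(1 − x²)`; `N = s₃ − x s₄`, `D² = (1 − x²)(1 − s₄²)`) and
  the rhombus corner at `a` (`N = x − s₁s₂`, `D² = (1 − s₁²)(1 − s₂²)`);
* the vertex conditions at `v` and at `a` in product form `Π (C + S·I) = 1` (`cprodR`), and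
  `C_j² + S_j² = 1` for the regular corners;
* the box: `x ∈ [−0.3454, 0.502]` (`soft_rhombus_diag_ge`, separation), `s_i ∈ [0.497, 0.502]`,
  `C_j ∈ [0.3252, 0.3415]`, `S_j ∈ [0.9398, 0.9457]` (soft-triangle corner window) — valid for every
  `η ∈ [0, 10⁻³]`.

`rhombusClaim_holds`: for all `m_v, m_a ≤ 5` the system has NO real solution in the box — 36 kd-tree
certificates over the single axis `x` (40 leaves in total, precision `2⁻²⁰`, 6 Heron steps), found by
`work/certgen.py` (which replicates `RExpr.enclose` exactly) and checked here by the kernel.  The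
geometric translation (hull data ⇒ a solution) is the sibling file `…RhombusIsolated.lean`.
-/

namespace Summit.AtomisticToContinuum.Crystallization.Theorems

open Literature.Analysis.ValidatedNumerics

/-- Complex product of two `(re, im)` pairs of terms. -/
def cmulR (p q : RExpr × RExpr) : RExpr × RExpr :=
  (.sub (.mul p.1 q.1) (.mul p.2 q.2), .add (.mul p.1 q.2) (.mul p.2 q.1))

/-- Complex product of a list of `(re, im)` pairs of terms (`[] ↦ (1, 0)`). -/
def cprodR : List (RExpr × RExpr) → RExpr × RExpr
  | [] => (.const 1, .const 0)
  | p :: l => cmulR p (cprodR l)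

/-- The `(cos, sin)` pair of a corner with `cos = N / √D²`, in forward form:
`(N · (√D²)⁻¹, √(1 − (N · (√D²)⁻¹)²))`. -/
def cornerR (N Dsq : RExpr) : RExpr × RExpr :=
  (.mul N (.inv (.sqrt Dsq)), .sqrt (.sub (.const 1) (.sq (.mul N (.inv (.sqrt Dsq))))))

/-- `n` pairs of variables `(x_k, x_{k+1}), (x_{k+2}, x_{k+3}), …` (the regular corners). -/
def regVars (k n : ℕ) : List (RExpr × RExpr) :=
  (List.range n).map fun j => (.var (k + 2 * j), .var (k + 2 * j + 1))

/-- The half-rhombus corner `∠(a, v, w)`: `N = s₂ − s₁ x`, `D² = (1 − s₁²)(1 − x²)`. -/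
def phi1R : RExpr × RExpr :=
  cornerR (.sub (.var 2) (.mul (.var 1) (.var 0)))
    (.mul (.sub (.const 1) (.sq (.var 1))) (.sub (.const 1) (.sq (.var 0))))

/-- The half-rhombus corner `∠(w, v, c)`: `N = s₃ − x s₄`, `D² = (1 − x²)(1 − s₄²)`. -/
def phi2R : RExpr × RExpr :=
  cornerR (.sub (.var 3) (.mul (.var 0) (.var 4)))
    (.mul (.sub (.const 1) (.sq (.var 0))) (.sub (.const 1) (.sq (.var 4))))

/-- The rhombus corner `∠(v, a, w)`: `N = x − s₁ s₂`, `D² = (1 − s₁²)(1 − s₂²)`. -/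
def betaR : RExpr × RExpr :=
  cornerR (.sub (.var 0) (.mul (.var 1) (.var 2)))
    (.mul (.sub (.const 1) (.sq (.var 1))) (.sub (.const 1) (.sq (.var 2))))

/-- The equations of the isolated-rhombus system with `mv` regular corners at `v` and `ma` at `a`:
unit circle for each regular corner, then the vertex conditions at `v` and at `a` (real part `− 1`,
imaginary part). -/
def rhombusHs (mv ma : ℕ) : List RExpr :=
  ((regVars 5 mv ++ regVars (5 + 2 * mv) ma).map fun p => .sub (.add (.sq p.2) (.sq p.1)) (.const 1)) ++
    [.sub (cprodR ([phi1R, phi2R] ++ regVars 5 mv)).1 (.const 1),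
      (cprodR ([phi1R, phi2R] ++ regVars 5 mv)).2,
      .sub (cprodR ([betaR] ++ regVars (5 + 2 * mv) ma)).1 (.const 1),
      (cprodR ([betaR] ++ regVars (5 + 2 * mv) ma)).2]

/-- The box of the isolated-rhombus system (valid for all `η ∈ [0, 10⁻³]`). -/
def rhombusBox (mv ma : ℕ) : Box :=
  [((-3454) / 10000, 502 / 1000)] ++ List.replicate 4 (497 / 1000, 502 / 1000) ++
    (List.replicate (mv + ma) [((3252 : ℚ) / 10000, (3415 : ℚ) / 10000),
      ((9398 : ℚ) / 10000, (9457 : ℚ) / 10000)]).flatten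

/-- The isolated-rhombus infeasibility claim. -/
def rhombusClaim (mv ma : ℕ) : RInfeasClaim := ⟨[], rhombusHs mv ma, rhombusBox mv ma⟩

/-- **The isolated soft rhombus is infeasible (kernel certificates).** For all `m_v, m_a ≤ 5` the
system `rhombusClaim m_v m_a` has no real solution in its box. -/
theorem rhombusClaim_holds : ∀ mv ma : ℕ, mv ≤ 5 → ma ≤ 5 → (rhombusClaim mv ma).Holds := by
  intro mv ma hmv hma
  interval_cases mv <;> interval_cases ma
  · exact RInfeasClaim.holds_of_check _ (.leaf (20, 6)) (by decide +kernel)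
  · exact RInfeasClaim.holds_of_check _ (.leaf (20, 6)) (by decide +kernel)
  · exact RInfeasClaim.holds_of_check _ (.leaf (20, 6)) (by decide +kernel)
  · exact RInfeasClaim.holds_of_check _ (.leaf (20, 6)) (by decide +kernel)
  · exact RInfeasClaim.holds_of_check _ (.leaf (20, 6)) (by decide +kernel)
  · exact RInfeasClaim.holds_of_check _ (.leaf (20, 6)) (by decide +kernel)
  · exact RInfeasClaim.holds_of_check _ (.leaf (20, 6)) (by decide +kernel)
  · exact RInfeasClaim.holds_of_check _ (.leaf (20, 6)) (by decide +kernel)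
  · exact RInfeasClaim.holds_of_check _ (.leaf (20, 6)) (by decide +kernel)
  · exact RInfeasClaim.holds_of_check _ (.leaf (20, 6)) (by decide +kernel)
  · exact RInfeasClaim.holds_of_check _ (.leaf (20, 6)) (by decide +kernel)
  · exact RInfeasClaim.holds_of_check _ (.leaf (20, 6)) (by decide +kernel)
  · exact RInfeasClaim.holds_of_check _ (.leaf (20, 6)) (by decide +kernel)
  · exact RInfeasClaim.holds_of_check _ (.leaf (20, 6)) (by decide +kernel)
  · exact RInfeasClaim.holds_of_check _ (.leaf (20, 6)) (by decide +kernel)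
  · exact RInfeasClaim.holds_of_check _ (.leaf (20, 6)) (by decide +kernel)
  · exact RInfeasClaim.holds_of_check _ (.leaf (20, 6)) (by decide +kernel)
  · exact RInfeasClaim.holds_of_check _ (.leaf (20, 6)) (by decide +kernel)
  · exact RInfeasClaim.holds_of_check _ (.leaf (20, 6)) (by decide +kernel)
  · exact RInfeasClaim.holds_of_check _ (.leaf (20, 6)) (by decide +kernel)
  · exact RInfeasClaim.holds_of_check _ (.leaf (20, 6)) (by decide +kernel)
  · exact RInfeasClaim.holds_of_check _ (.leaf (20, 6)) (by decide +kernel)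
  · exact RInfeasClaim.holds_of_check _ (.split 0 (783/10000) (.leaf (20, 6)) (.split 0 (5803/20000) (.leaf (20, 6)) (.split 0 (15843/40000) (.leaf (20, 6)) (.leaf (20, 6))))) (by decide +kernel)
  · exact RInfeasClaim.holds_of_check _ (.leaf (20, 6)) (by decide +kernel)
  · exact RInfeasClaim.holds_of_check _ (.leaf (20, 6)) (by decide +kernel)
  · exact RInfeasClaim.holds_of_check _ (.leaf (20, 6)) (by decide +kernel)
  · exact RInfeasClaim.holds_of_check _ (.leaf (20, 6)) (by decide +kernel)
  · exact RInfeasClaim.holds_of_check _ (.leaf (20, 6)) (by decide +kernel)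
  · exact RInfeasClaim.holds_of_check _ (.split 0 (783/10000) (.leaf (20, 6)) (.leaf (20, 6))) (by decide +kernel)
  · exact RInfeasClaim.holds_of_check _ (.leaf (20, 6)) (by decide +kernel)
  · exact RInfeasClaim.holds_of_check _ (.leaf (20, 6)) (by decide +kernel)
  · exact RInfeasClaim.holds_of_check _ (.leaf (20, 6)) (by decide +kernel)
  · exact RInfeasClaim.holds_of_check _ (.leaf (20, 6)) (by decide +kernel)
  · exact RInfeasClaim.holds_of_check _ (.leaf (20, 6)) (by decide +kernel)
  · exact RInfeasClaim.holds_of_check _ (.leaf (20, 6)) (by decide +kernel)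
  · exact RInfeasClaim.holds_of_check _ (.leaf (20, 6)) (by decide +kernel)

end Summit.AtomisticToContinuum.Crystallization.Theorems
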